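import Literature.Probability.Percolation.TriMarkedForget
import HarnessLib

/-!
# Five-marked discrete domains: interfaces, link patterns, and the five-marked loop lemma (statements)

Topic `Literature/Probability/Percolation`; lane pcv-sawmu (CriticalPhenomena), door (v) «five-point observables on the
honeycomb». This file is the DEFINITION layer («D1-v2», b-engine-2 g4, sketch a966a2f4) and the typed faces + checked
skeleton of the five-marked loop lemma («Sketch v22 ed.4», a-idea-2 g10, sha16 e2a7b7c1). The Lean STATEMENTS are carried
verbatim from the lane's HOME text; what differs: the namespace (`Literature.Probability.Percolation.FivePoint`), the
provenance tags, an explicit domain binder `(D : TriMarkedDomain 5)` on the eighteen face predicates, and the omission of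
the two typed CONJECTURES (N) `HexFivePointNormalisation` / (H) `HexFivePointHolomorphy` of the sketch (they are
unproved five-point statements, not printed results, and stay in the lane's HOME sketch until filed as obligations).
The proofs for EVERY `D : TriMarkedDomain 5` are in `FiveMarkedLoopStubs.lean` (locality, parity, degree, uniqueness,
image), `FiveMarkedLoopLemma.lean` (reach, the two crossing identifications, the lemma) and `FiveMarkedLoopSpace.lean`
(injectivity, the `2 ^ #G` count, surjectivity of the colouring ↦ loop-configuration map).

Content. For a five-marked discrete domain `D : TriMarkedDomain 5` (Bollobás–Riordan 2006, Ch. 7 §7.2.2), a reference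
corner `r : Fin 5` and a super-arc colour `c`: the outer colouring `arcColour` (colour changes at the four marks
`j ≠ r`), bicoloured edges `Bicol`/`IStep` of the hexagonal graph `H_G` («e ∈ ξ(σ) iff the colors on the left and on the
right of e differ», KhS21 p. 4), corner faces `IsCornerFace`, the interface part `InInterface`, the events
`Joined`/`midEdgeEvent`/`midEdgeProb`/`patternProb` and the observable ingredients `tau`/`sparseObs`/`ccwNbr`; then the
loop-lemma faces `bicolDeg`, `LoopParity`, `LoopDegLeTwo`, `LoopReach`, `LoopUnique`, `MatchBOpen`, `MatchAClosed`,
`FiveMarkedLoopLemma(')`, `LoopFlip`, `CrossFlip`, the loop space `hBonds`/`xiOf`/`xiDeg`/`loopSpace` with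
`LoopImage`/`LoopInj`/`LoopSurj`/`LoopCount`/`KhSLemma2Face`, the locality faces `LoopLocal`/`CrossLocal`, the finite form
`FiveMarkedLoopLemmaFin`, and the checked reductions `loop5_of_stubs`, `loop5'_of`, `loop5_of_fin`, `fin_of_loop5`,
`crossLocal_holds`, `loop5_of_fin'`.

Status in print (lane label cell, lit-2): the loop lemma is Khristoforov–Smirnov 2021 §1.2 Lemma 2 (arXiv:2111.15612
p. 4) = Bollobás–Riordan 2006 Ch. 7 Lemma 5's colouring/loop bijection, instantiated per reference corner of a five-marked
domain (the mark `v_r` forgotten, disorders at the corner faces `y_{r+1..r+4}`); a printed lemma in the B–R vocabulary —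
its kernel content is new only as text.

## References
* M. Khristoforov, S. Smirnov, *Percolation and O(1) loop model*, arXiv:2111.15612 (2021), §1.2 (Def. 3, Lemma 2, Lemma 4).
* B. Bollobás, O. Riordan, *Percolation*, Cambridge University Press (2006), Ch. 7 §7.2.2 pp. 168–171 (Lemma 5, Fig. 9).
-/

/-!
# Part 1 — the interface layer (lane sketch D1-v2; the typed conjectures (N)/(H) of the sketch are NOT in this file)

Statement (N) of `HOME/pub-sawmu-b-engine-2/gen4/D6-PILOT.md` §9 addendum 1, typed by route (i) of addendum 2
(an explicit INTERFACE layer on top of Bollobás–Riordan's site-marked `TriMarkedDomain 5`).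

Setting. `D : TriMarkedDomain 5` (five marked boundary darts, anticlockwise), site percolation at
`p = 1/2` on the hexagons of `G = D.verts`. For a REFERENCE index `r : Fin 5` and a colour `c : Bool`
the outer hexagons along the stretch `i` are coloured `arcColour r c i`: the two stretches `r - 1`, `r`
meeting at the marked site `v_r` ("super-arc") get colour `c`, then `r + 1 ↦ ¬c`, `r + 2 ↦ c`, `r + 3 ↦ ¬c`
(four colour changes, at `v_{r+1}, …, v_{r+4}`). An edge of the hexagonal lattice `H` (a pair of
adjacent faces of `𝕋`, dual to a bond `{u, v}` of `𝕋` with at least one endpoint in `G`) is BICOLOURED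
when the two hexagons it separates have different colours (the outer one read from `arcColour`). The
INTERFACE PART `IP` is the set of faces reachable from the corner faces of the four colour-change marks
through bicoloured edges (= the two interface paths; loops never meet a corner). A face `x` is JOINED to
the reference corner if a chain of `H_G`-edges avoiding `IP` links the corner face of `v_r` to `x`.

(N) For every colour `c` and every inner edge `{x, x'}` of `H_G` (adjacent faces across a bond of `G`,
`x` an interior face):  `Σ_{r : Fin 5} P_{1/2}[ x or x' is joined to the corner of v_r under (r, c) ] = 1`.

Evidence (pilot, exact): uniform honeycomb rhombus R44, 36 five-mark sets: 0 violations in 3 888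
(row, colour, position) checks; ℤ² bond analogue: violated on all 432 (D6-PILOT §3, `gen4/code/ae_report.py`).
Mechanism: K1′ transport of R-STAR-PROOF §2 (each summand counts the loop configurations with
disorders `{u_0, …, u_4, e}` in which `e` is linked to `u_r`) + the link patterns partition that space
[KhristoforovSmirnov2021, §1.2 and Def. 3 for three disorders]. Corner convention: the corner face of
mark `i` is the face spanned by `v_i`, the head of the marked dart and the head of its predecessor
(`y_i`). (N) is recorded here only in this comment (a typed conjecture of the lane, kept in its HOME sketch).
-/

open Finset

noncomputable section

namespace Literature.Probability.Percolation.FivePoint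

open Literature.Probability.Percolation Literature.Probability.LatticeModels

variable (D : TriMarkedDomain 5)

/-- The stretch index of a boundary dart of `D` (junk `0` off the boundary): the least `i` with `d ∈ D.stretch i`
(the stretches are disjoint, so "least" is immaterial); written with `Finset.min'` so that `decide` can evaluate it on
concrete domains (b-step0 g8's S0 remark; v1 used `Exists.choose`). [folklore] -/
def stretchIdx (d : Site 2 × Site 2) : Fin 5 :=
  if h : (Finset.univ.filter fun i : Fin 5 => d ∈ D.stretch i).Nonempty then
    (Finset.univ.filter fun i : Fin 5 => d ∈ D.stretch i).min' h
  else 0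

/-- Outer colour of stretch `i` under reference `r` and super-arc colour `c`: with
`q = (i - r + 1) mod 5`, stretches `q ∈ {0, 1}` (i.e. `i = r - 1, r`) get `c`, `q = 2 ↦ ¬c`,
`q = 3 ↦ c`, `q = 4 ↦ ¬c`. [folklore] -/
def arcColour (r : Fin 5) (c : Bool) (i : Fin 5) : Bool :=
  let q : ℕ := (i.val + 6 - r.val) % 5
  if q ≤ 1 then c else if q % 2 = 0 then !c else c

/-- The hexagonal edge dual to the bond `{u, v}` of `𝕋` is bicoloured in the site configuration `σ`
under the boundary condition `(r, c)`: both sites in `G` with different states, or one site `u ∈ G`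
and the other outside with `σ u` differing from the outer colour of the stretch of the dart `(u, v)`.
[cite: KhristoforovSmirnov2021, §1.2 (colourings ↔ loop configurations, pp. 3–4)] -/
def Bicol (σ : SiteConfig (Site 2)) (r : Fin 5) (c : Bool) (u v : Site 2) : Prop :=
  (u ∈ D.verts ∧ v ∈ D.verts ∧ (u ∈ σ ↔ v ∉ σ)) ∨
  (u ∈ D.verts ∧ v ∉ D.verts ∧ (u ∈ σ ↔ arcColour r c (stretchIdx D (u, v)) = false)) ∨
  (v ∈ D.verts ∧ u ∉ D.verts ∧ (v ∈ σ ↔ arcColour r c (stretchIdx D (v, u)) = false))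

/-- A step of the hexagonal graph `H_G` of the domain: adjacent faces of `𝕋` whose common bond has at
least one endpoint in `G`. [cite: KhristoforovSmirnov2021, §1.2 (colourings ↔ loop configurations, pp. 3–4)] -/
def HStep (F F' : HexVertex) : Prop :=
  hexGraph.Adj F F' ∧ ∃ u ∈ faceEdge F F', u ∈ D.verts

/-- A step along a BICOLOURED edge of `H_G` under `(σ, r, c)`. [cite: KhristoforovSmirnov2021, §1.2 (colourings ↔ loop configurations, pp. 3–4)] -/
def IStep (σ : SiteConfig (Site 2)) (r : Fin 5) (c : Bool) (F F' : HexVertex) : Prop :=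
  hexGraph.Adj F F' ∧ ∃ u v : Site 2, faceEdge F F' = {u, v} ∧ Bicol D σ r c u v

/-- The boundary dart preceding the `i`-th marked dart (same tail `v_i`, by `mark_pred`). [folklore] -/
def predDart (i : Fin 5) : Site 2 × Site 2 :=
  triBdryIter D.verts D.base (D.pos i + (D.bdryLen - 1))

/-- `F` is the CORNER FACE `y_i` of the `i`-th mark: the face of `𝕋` spanned by the marked site `v_i`,
the head of its marked dart and the head of the preceding dart (a type-II boundary vertex of `H_G`).
[cite: BollobasRiordan2006, Ch. 7 §7.2.2 pp. 168–171] -/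
def IsCornerFace (i : Fin 5) (F : HexVertex) : Prop :=
  hexFaceVertices F = {D.markSite i, (D.markDart i).2, (predDart D i).2}

/-- The INTERFACE PART under `(σ, r, c)`: faces reachable through bicoloured edges from a corner face
of one of the four colour-change marks `j ≠ r`. [cite: KhristoforovSmirnov2021, §1.2 (colourings ↔ loop configurations, pp. 3–4)] -/
def InInterface (σ : SiteConfig (Site 2)) (r : Fin 5) (c : Bool) (F : HexVertex) : Prop :=
  ∃ j : Fin 5, j ≠ r ∧ ∃ Y : HexVertex, IsCornerFace D j Y ∧ Relation.ReflTransGen (IStep D σ r c) Y F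

/-- The face `x` is JOINED to the reference corner `y_r` off the interfaces: a chain of `H_G`-steps
through faces not in the interface part links a corner face of mark `r` to `x`. [cite: KhristoforovSmirnov2021, §1.2 (colourings ↔ loop configurations, pp. 3–4)] -/
def Joined (σ : SiteConfig (Site 2)) (r : Fin 5) (c : Bool) (x : HexVertex) : Prop :=
  ¬ InInterface D σ r c x ∧ ∃ Y : HexVertex, IsCornerFace D r Y ∧ ¬ InInterface D σ r c Y ∧
    Relation.ReflTransGen (fun F F' => HStep D F F' ∧ ¬ InInterface D σ r c F ∧ ¬ InInterface D σ r c F') Y x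

/-- The mid-edge event at the `H_G`-edge `{x, x'}`: one of its two endpoint faces is joined to `y_r`.
[folklore] -/
def midEdgeEvent (r : Fin 5) (c : Bool) (x x' : HexVertex) : Set (SiteConfig (Site 2)) :=
  {σ | Joined D σ r c x ∨ Joined D σ r c x'}

/-- Its probability at `p = 1/2`. [folklore] -/
def midEdgeProb (r : Fin 5) (c : Bool) (x x' : HexVertex) : ℝ :=
  (triSitePercolation half).real (midEdgeEvent D r c x x')

/-! ### Ingredients of the five-point observables (D6-PILOT §9): `ccwNbr`, matchings, `patternProb`, `tau`, `sparseObs` -/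

/-- The three neighbours of a face of `𝕋` in COUNTER-CLOCKWISE order (equilateral embedding, `e₁` at
`+60°`): for the up triangle `(x, 0)` the down triangles of the cells `x - e₁` (below), `x` (upper
right), `x - e₀` (upper left); for the down triangle `(y, 1)` the up triangles of `y + e₁` (above),
`y` (lower left), `y + e₀` (lower right). Cyclic rotations are immaterial for (H). [folklore] -/
def ccwNbr (f : HexVertex) (k : Fin 3) : HexVertex :=
  if f.2 = 0 then
    ![(f.1 - Pi.single 1 1, 1), (f.1, 1), (f.1 - Pi.single 0 1, 1)] k
  else
    ![(f.1 + Pi.single 1 1, 0), (f.1, 0), (f.1 + Pi.single 0 1, 0)] k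

/-- Matching `A` under `(σ, r, c)`: the corner faces of the marks `r + 1` and `r + 2` lie on the same
interface (are linked through bicoloured edges). [cite: KhristoforovSmirnov2021, §1.2 (colourings ↔ loop configurations, pp. 3–4)] -/
def MatchA (σ : SiteConfig (Site 2)) (r : Fin 5) (c : Bool) : Prop :=
  ∃ Y₁ Y₂ : HexVertex, IsCornerFace D (r + 1) Y₁ ∧ IsCornerFace D (r + 2) Y₂ ∧
    Relation.ReflTransGen (IStep D σ r c) Y₁ Y₂

/-- Matching `B` under `(σ, r, c)`: the corner faces of the marks `r + 1` and `r + 4` are linked.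
[cite: KhristoforovSmirnov2021, §1.2 (colourings ↔ loop configurations, pp. 3–4)] -/
def MatchB (σ : SiteConfig (Site 2)) (r : Fin 5) (c : Bool) : Prop :=
  ∃ Y₁ Y₂ : HexVertex, IsCornerFace D (r + 1) Y₁ ∧ IsCornerFace D (r + 4) Y₂ ∧
    Relation.ReflTransGen (IStep D σ r c) Y₁ Y₂

/-- `H_{r,M}(e)`: probability that the matching is `M` (`A` if `m = false`, `B` if `m = true`) and one
endpoint face of the edge `e = {x, x'}` is joined to the corner of `v_r`. [folklore] -/
def patternProb (r : Fin 5) (c m : Bool) (x x' : HexVertex) : ℝ :=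
  (triSitePercolation half).real
    {σ | (if m then MatchB D σ r c else MatchA D σ r c) ∧ (Joined D σ r c x ∨ Joined D σ r c x')}

/-- `τ = e^{2πi/3}`. [folklore] -/
def tau : ℂ := Complex.exp (2 * Real.pi * Complex.I / 3)

/-- The sparse five-point observable `F_j(e) = H_{j,A}(e) - τ² H_{j+1,B}(e) - τ H_{j-1,B}(e)`
(D6-PILOT §9; `j - 1 = j + 4` in `Fin 5`). [folklore] -/
def sparseObs (j : Fin 5) (c : Bool) (x x' : HexVertex) : ℂ :=
  (patternProb D j c false x x' : ℂ) - tau ^ 2 * (patternProb D (j + 1) c true x x' : ℂ)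
    - tau * (patternProb D (j + 4) c true x x' : ℂ)

end Literature.Probability.Percolation.FivePoint

end

/-! # Part 2 — the five-marked loop lemma: faces and checked skeleton (lane sketch v22 ed.4, a-idea-2; statements verbatim)

## (v-c) «FIVE-MARKED LOOP LEMMA» — Khristoforov–Smirnov 2021 §1.2 Lemma 2, per corner, in the B–R vocabulary

PRINTED (arXiv:2111.15612, lit-2 pack 17:29:45Z, as printed): objects p0003:L91–p0004:L14 («∂ξ = the vertices and
mid-edges adjacent to an odd number of half-edges of ξ», «W_Ω(U) := {ξ : ∂ξ = U}», «ξ ∖ IP(ξ) is a union of disjoint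
loops and IP(ξ) is a union of disjoint paths, matching marked points», «exactly 2^{#Faces(Ω)} loop configurations
with given disorders»); LEMMA 2 p0004:L22–L31 («either u₁ is linked to u₂ and u₃ to u₄ … or u₁ is linked to u₄ and
u₂ to u₃»; «P^perc_Ω[∂_{u₁u₂}Ω ↔ ∂_{u₃u₄}Ω] = P^loop_{Ω,{u₁,…,u₄}}[u₁↔u₄, u₂↔u₃]»); PROOF RULE p0004:L33–L39 («e ∈ ξ(σ)
iff the colors on the left and on the right of e differ … a bijection between colorings and loop configurations
with disorders at u₁,…,u₄, moreover ∂_{u₁u₂}Ω ↔ ∂_{u₃u₄}Ω in σ iff [u₁↔u₄, u₂↔u₃] in ξ(σ)»).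

DICTIONARY (checkable): Ω ↦ the hexagons of `D.verts` (`D : TriMarkedDomain 5` with the mark `v_r` forgotten,
`TriMarkedDomain.forget r`, tree p335665); marked points `u₁,…,u₄` ↦ the CORNER FACES `y_{r+1}, y_{r+2}, y_{r+3},
y_{r+4}` (`IsCornerFace`, vertex disorders instead of mid-edge disorders — B–R's `yᵢ`, Fig. 9); arcs `∂_{u₁u₂}Ω,
∂_{u₃u₄}Ω` ↦ `D.arc (r+1)`, `D.arc (r+3)`; outer colours ↦ `arcColour r c` (c = false is the tree's `bcolOf` on
`D.forget r`: `A_{r+1}, A_{r+3}` open); «colors differ across e» ↦ `Bicol`; «linked in IP(ξ(σ))» ↦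
`Relation.ReflTransGen (IStep …)` between corner faces, i.e. `MatchA` = [u₁↔u₂], `MatchB` = [u₁↔u₄];
«∂_{u₁u₂}Ω ↔ ∂_{u₃u₄}Ω» ↦ `D.IsOpenCrossing σ (r+1) (r+3)`; P^loop (uniform on W_Ω(U), x = n = 1) ↦ counting measure
on `loopSpace D r`.

CONVENTIONS PINNED (lit-2 18:06:33Z (ii)(iii), print side — no objection): (a) DISORDERS sit at the corner VERTICES
`y_j` of `H` (= KhS21's boundary MID-EDGE disorders `u_j` up to toggling the terminal half-edge `y_j–u_j`, a bijection
`W_Ω(y's) ≅ W_Ω(u's)` preserving loops and link patterns; print defines `∂ξ` over «vertices and mid-edges» p0003:L91–L92);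
(b) COLOURS: in `Bicol` the outer colour `true` plays the role of an OPEN site (`u ∈ σ ↔ arcColour … = false` is the
"differ" clause), and `arcColour r c` gives the arcs `A_{r+1}`, `A_{r+3}` the colour `!c` and `A_{r+2}`, `A_{r+4} ∪ A_r`
the colour `c`; hence under `c = false` the arcs `A_{r+1} = ∂_{u₁u₂}Ω` and `A_{r+3} = ∂_{u₃u₄}Ω` are OPEN (print: «blue
along ∂₁₂Ω and ∂₃₄Ω» p0004:L36, and «↔» is a blue path p0003:L66–L70) — exactly the tree's `bcolOf` on `D.forget r`
(stretches 0, 2 open) — so `MatchBOpen` (pattern B = [u₁↔u₄, u₂↔u₃] ⇒ OPEN crossing `A_{r+1} ↔ A_{r+3}`) is the printed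
direction p0004:L37–L39, and `MatchAClosed` is its dual (B–R Ch. 7 Lemma 5; `A_{r+4} ∪ A_r` = print's single arc ∂₄₁Ω
of the four-marked domain).

WHAT IS TREE ALREADY: the 4-marked interface walk (`TriDiscInterface`: `bdryCol`/`vcol`/`IsIface`/`ifaceNext`,
`isOpenCrossing_or_isClosedCrossing`) and exclusivity (`TriDualityProofs`), packaged for five marks as
`five_markedDomain_duality` (open `A_{r+1}↔A_{r+3}` XOR closed `A_{r+2} → A_{r+4} ∪ A_r`). WHAT IS NEW HERE (first
kernel text): the GLOBAL loop configuration `ξ_{r,c}(σ)` (all bicoloured edges, not one traced component), its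
disorder set (`LoopParity`), the link-pattern dichotomy for the D1-v2 events (`Xor MatchA MatchB`) and their
IDENTIFICATION with the B–R crossing events (`MatchB ↔ open crossing`), plus the colouring ↔ loop-space bijection
(`LoopInj`/`LoopSurj`/`LoopCount`) and the printed equation (`KhSLemma2Face`).

SKELETON (checked): `loop5_of_stubs : LoopReach → LoopUnique → MatchBOpen → MatchAClosed → FiveMarkedLoopLemma`
(real proof, uses the tree's `five_markedDomain_duality`); the four stubs are the staffable pieces (see each
docstring for size and why it might fail). Consistency (T5-style): every stub is an instance of the printed Lemma 2
/ B–R Lemma 5 mechanism on a genuine discrete domain; no stub implies another's negation; none is vacuous (corner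
faces exist for every mark: the marked dart and its predecessor share the tail `vᵢ` (`mark_pred`) and consecutive
darts span a face).
-/

noncomputable section

namespace Literature.Probability.Percolation.FivePoint

open Literature.Probability.Percolation Literature.Probability.LatticeModels

variable (D : TriMarkedDomain 5)

/-! ### B-side: the loop configuration of a colouring, its disorders, link patterns vs crossings -/

open Classical in
/-- `ξ`-degree of the face `F` of `𝕋` (= vertex of `H`) in the loop configuration `ξ_{r,c}(σ)`: the number of
BICOLOURED `H_G`-edges at `F`; the edge of `F` towards `oppFace F j` is dual to the bond
`{faceVertex F (j+1), faceVertex F (j+2)}`. [KhS21 p0003:L91 «adjacent to an odd number of half-edges»] [cite: KhristoforovSmirnov2021, §1.2 Lemma 2 (p. 4)] -/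
def bicolDeg (σ : SiteConfig (Site 2)) (r : Fin 5) (c : Bool) (F : HexVertex) : ℕ :=
  #((Finset.univ : Finset (Fin 3)).filter fun j => Bicol D σ r c (faceVertex F (j + 1)) (faceVertex F (j + 2)))

/-- **(P) DISORDERS = the four colour-change corners** («∂ξ(σ) = {u₁,…,u₄}»): the `ξ_{r,c}(σ)`-degree of a face is
odd iff it is the corner face `y_j` of a mark `j ≠ r`. Mechanism: three Boolean cells around an `H`-vertex give an
even number of unequal adjacent pairs; at a boundary vertex only the two `H_G`-edges count and the outer colour
switches exactly at the corners `y_j`, `j ≠ r` (`arcColour`: `A_{r+4} ∪ A_r` one colour). SIZE S–M.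
WHY IT MIGHT FAIL: only through a convention slip (`stretchIdx` junk value `0` off the boundary; `predDart` at
`pos 0`), which the proof would expose. [KhS21 §1.2 p0004:L33–L39; BollobasRiordan2006 Ch. 7 p. 170] [cite: KhristoforovSmirnov2021, §1.2 Lemma 2 (p. 4)] -/
def LoopParity (D : TriMarkedDomain 5) : Prop :=
  ∀ (σ : SiteConfig (Site 2)) (r : Fin 5) (c : Bool) (F : HexVertex),
    Odd (bicolDeg D σ r c F) ↔ ∃ j : Fin 5, j ≠ r ∧ IsCornerFace D j F

/-- (P′) no face has three bicoloured edges (two colours only; at corner faces the third edge is not in `H_G`). [cite: KhristoforovSmirnov2021, §1.2 Lemma 2 (p. 4)] -/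
def LoopDegLeTwo (D : TriMarkedDomain 5) : Prop :=
  ∀ (σ : SiteConfig (Site 2)) (r : Fin 5) (c : Bool) (F : HexVertex), bicolDeg D σ r c F ≤ 2

/-- **(B-reach)** the interface component of `y_{r+1}` reaches `y_{r+2}` or `y_{r+4}` (link pattern A or B — never
`[u₁↔u₃]`). Mechanism: B–R's oriented interface walk from `y_{r+1}` in `D.forget r` (tree `TriDiscInterface`,
`exists_partialOrbit_end` … `isOpenCrossing_or_isClosedCrossing`) ends at the face of the mark `1` or `3` of
`D.forget r`; bridge `IStep D σ r false` ↔ the tree's `IsIface` steps on `D.forget r` (`c = true` by the colour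
flip `σ ↦ σᶜ`). SIZE M (bridge lemmas `IsCornerFace D (r+1+i) F ↔ F = corner of mark i of D.forget r`,
`Bicol ↔ vcol ≠ vcol`). WHY IT MIGHT FAIL: the tree walk's terminal face is characterised inside a proof, not as
a public lemma — may need a small tree-side exposure (`done_of_isTerminal`). [BollobasRiordan2006 Ch. 7 Lemma 5
pp. 169–171, Fig. 9; KhS21 Lemma 2 p0004:L22–L25] [cite: KhristoforovSmirnov2021, §1.2 Lemma 2 (p. 4)] -/
def LoopReach (D : TriMarkedDomain 5) : Prop :=
  ∀ (σ : SiteConfig (Site 2)) (r : Fin 5) (c : Bool), MatchA D σ r c ∨ MatchB D σ r c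

/-- **(B-unique)** not both patterns: `y_{r+1}` has `ξ`-degree one and every face degree `≤ 2` (P, P′), so its
`IStep`-component is a simple path with exactly one other odd face. SIZE M (finite max-degree-2 graphs: component of
a degree-1 vertex is a path; count odd vertices). WHY IT MIGHT FAIL: `Relation.ReflTransGen (IStep …)` links
FACES, and a face of degree 2 is passed through, so "component" = path support — fine; fails only if (P′) failed.
[KhS21 p0004:L8–L10 «IP(ξ) is a union of disjoint paths, matching marked points»] [cite: KhristoforovSmirnov2021, §1.2 Lemma 2 (p. 4)] -/
def LoopUnique (D : TriMarkedDomain 5) : Prop :=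
  ∀ (σ : SiteConfig (Site 2)) (r : Fin 5) (c : Bool), ¬ (MatchA D σ r c ∧ MatchB D σ r c)

/-- **(B-open)** pattern B under `c = false` gives an OPEN crossing `A_{r+1} ↔ A_{r+3}`: the open cells on the
right of the interface from `y_{r+1}` to `y_{r+4}` are successively equal or adjacent and run from `A_{r+1}⁺`'s
side to `A_{r+3}` (B–R p. 171). SIZE M; = the tree's crossing extraction in `isOpenCrossing_or_isClosedCrossing`
transported through `forget r` and the `IStep` bridge. WHY IT MIGHT FAIL: as (B-reach) — needs the tree's
"ends at y₄ ⇒ open crossing" as a lemma rather than a proof step. [BollobasRiordan2006 Ch. 7 p. 171; KhS21 p0004:L38–L39] [cite: BollobasRiordan2006, Ch. 7 Lemma 5 pp. 169–171] -/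
def MatchBOpen (D : TriMarkedDomain 5) : Prop :=
  ∀ (σ : SiteConfig (Site 2)) (r : Fin 5), MatchB D σ r false → D.IsOpenCrossing σ (r + 1) (r + 3)

/-- **(B-closed)** pattern A under `c = false` gives a CLOSED crossing from `A_{r+2}` to the merged arc
`A_{r+4} ∪ A_r` (the closed cells on the left of the interface from `y_{r+1}` to `y_{r+2}`). SIZE M (mirror of
(B-open)). WHY IT MIGHT FAIL: as (B-open). [BollobasRiordan2006 Ch. 7 p. 171] [cite: BollobasRiordan2006, Ch. 7 Lemma 5 pp. 169–171] -/
def MatchAClosed (D : TriMarkedDomain 5) : Prop :=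
  ∀ (σ : SiteConfig (Site 2)) (r : Fin 5), MatchA D σ r false →
    (D.IsClosedCrossing σ (r + 2) (r + 4) ∨ D.IsClosedCrossing σ (r + 2) r)

/-- **THE (v-c) TARGET, `c = false`** (outer colours of `D.forget r` = the tree's `bcolOf`): for every colouring
and every reference corner `r`, EXACTLY ONE of the link patterns A = [y_{r+1}↔y_{r+2}], B = [y_{r+1}↔y_{r+4}]
occurs, B iff there is an open crossing `A_{r+1} ↔ A_{r+3}`, A iff there is a closed crossing `A_{r+2} → A_{r+4} ∪ A_r`.
[KhS21 §1.2 Lemma 2 p0004:L22–L39; BollobasRiordan2006 Ch. 7 Lemma 5] [cite: KhristoforovSmirnov2021, §1.2 Lemma 2 (p. 4)] -/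
def FiveMarkedLoopLemma (D : TriMarkedDomain 5) : Prop :=
  ∀ (σ : SiteConfig (Site 2)) (r : Fin 5),
    Xor (MatchA D σ r false) (MatchB D σ r false) ∧
    (MatchB D σ r false ↔ D.IsOpenCrossing σ (r + 1) (r + 3)) ∧
    (MatchA D σ r false ↔ (D.IsClosedCrossing σ (r + 2) (r + 4) ∨ D.IsClosedCrossing σ (r + 2) r))

/-- The `c = true` twin (outer colours flipped): B iff a CLOSED crossing `A_{r+1} ↔ A_{r+3}`, A iff an OPEN
crossing `A_{r+2} → A_{r+4} ∪ A_r`. [KhS21 §1.2 Lemma 2 (colour symmetry)] [cite: KhristoforovSmirnov2021, §1.2 Lemma 2 (p. 4)] -/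
def FiveMarkedLoopLemma' (D : TriMarkedDomain 5) : Prop :=
  ∀ (σ : SiteConfig (Site 2)) (r : Fin 5),
    Xor (MatchA D σ r true) (MatchB D σ r true) ∧
    (MatchB D σ r true ↔ D.IsClosedCrossing σ (r + 1) (r + 3)) ∧
    (MatchA D σ r true ↔ (D.IsOpenCrossing σ (r + 2) (r + 4) ∨ D.IsOpenCrossing σ (r + 2) r))

/-- (flip) support face: complementing the colouring and the boundary colour changes no bicoloured edge, hence no
pattern. SIZE S (`Bicol` is a conjunction of "differ" clauses; `arcColour r (!c) = !arcColour r c`). [cite: KhristoforovSmirnov2021, §1.2 Lemma 2 (p. 4)] -/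
def LoopFlip (D : TriMarkedDomain 5) : Prop :=
  ∀ (σ : SiteConfig (Site 2)) (r : Fin 5) (c : Bool),
    (MatchA D σᶜ r (!c) ↔ MatchA D σ r c) ∧ (MatchB D σᶜ r (!c) ↔ MatchB D σ r c)

/-- (flip′) support face: open crossings of `σᶜ` are closed crossings of `σ` (definitional up to `Set.compl`). SIZE XS. [cite: KhristoforovSmirnov2021, §1.2 Lemma 2 (p. 4)] -/
def CrossFlip (D : TriMarkedDomain 5) : Prop :=
  ∀ (σ : SiteConfig (Site 2)) (i j : Fin 5),
    (D.IsOpenCrossing σᶜ i j ↔ D.IsClosedCrossing σ i j) ∧ (D.IsClosedCrossing σᶜ i j ↔ D.IsOpenCrossing σ i j)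

/-! ### The checked skeleton -/

/-- **(v-c) ⇐ (B-reach), (B-unique), (B-open), (B-closed)** — real proof, through the tree's five-marked duality. [cite: KhristoforovSmirnov2021, §1.2 Lemma 2 (p. 4)] -/
theorem loop5_of_stubs (h1 : LoopReach D) (h2 : LoopUnique D) (h3 : MatchBOpen D) (h4 : MatchAClosed D) :
    FiveMarkedLoopLemma D := by
  intro σ r
  have hd := five_markedDomain_duality D σ r
  unfold Xor at hd
  have hr := h1 σ r false
  have hu := h2 σ r false
  -- not both crossings, from the tree
  have hPQ : ¬ (D.IsOpenCrossing σ (r + 1) (r + 3) ∧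
      (D.IsClosedCrossing σ (r + 2) (r + 4) ∨ D.IsClosedCrossing σ (r + 2) r)) := by
    rintro ⟨p, q⟩
    rcases hd with ⟨_, nq⟩ | ⟨_, np⟩
    · exact nq q
    · exact np p
  refine ⟨?_, ⟨h3 σ r, fun hopen => ?_⟩, ⟨h4 σ r, fun hclosed => ?_⟩⟩
  · unfold Xor
    rcases hr with hA | hB
    · exact Or.inl ⟨hA, fun hB => hu ⟨hA, hB⟩⟩
    · exact Or.inr ⟨hB, fun hA => hu ⟨hA, hB⟩⟩
  · rcases hr with hA | hB
    · exact absurd ⟨hopen, h4 σ r hA⟩ hPQ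
    · exact hB
  · rcases hr with hA | hB
    · exact hA
    · exact absurd ⟨h3 σ r hB, hclosed⟩ hPQ

/-- The `c = true` twin from the `c = false` lemma and the two flip faces — real proof. [cite: KhristoforovSmirnov2021, §1.2 Lemma 2 (p. 4)] -/
theorem loop5'_of (hf : LoopFlip D) (hc : CrossFlip D) (h : FiveMarkedLoopLemma D) : FiveMarkedLoopLemma' D := by
  intro σ r
  obtain ⟨hx, hB, hA⟩ := h σᶜ r
  have fA := (hf σ r true).1
  have fB := (hf σ r true).2
  simp only [Bool.not_true] at fA fB
  refine ⟨?_, ?_, ?_⟩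
  · unfold Xor at hx ⊢
    rw [fA, fB] at hx
    exact hx
  · rw [← fB, hB, (hc σ (r + 1) (r + 3)).1]
  · rw [← fA, hA, (hc σ (r + 2) (r + 4)).2, (hc σ (r + 2) r).2]

/-! ### A-side: the loop space with disorders and the colouring bijection (KhS21 Lemma 2's equation) -/

open Classical in
/-- The edge set of `H_G` recorded by dual bonds: bonds `{u, v}` of `𝕋` with at least one endpoint in `G`
(interior bonds and boundary darts). [KhS21 p0003 «Edges(Ω)»] [cite: KhristoforovSmirnov2021, §1.2 (colourings ↔ loop configurations, pp. 3–4)] -/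
def hBonds : Finset (Sym2 (Site 2)) :=
  (((D.verts ∪ triOuterBdry D.verts) ×ˢ (D.verts ∪ triOuterBdry D.verts)).filter
      fun p => triGraph.Adj p.1 p.2 ∧ (p.1 ∈ D.verts ∨ p.2 ∈ D.verts)).image fun p => s(p.1, p.2)

open Classical in
/-- The loop configuration `ξ_{r,c}(σ) ⊆ Edges(H_G)` of a colouring: its bicoloured edges. [KhS21 p0004:L33–L36] [cite: KhristoforovSmirnov2021, §1.2 (colourings ↔ loop configurations, pp. 3–4)] -/
def xiOf (σ : SiteConfig (Site 2)) (r : Fin 5) (c : Bool) : Finset (Sym2 (Site 2)) :=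
  (hBonds D).filter fun e => ∃ u v : Site 2, e = s(u, v) ∧ Bicol D σ r c u v

/-- `ξ`-degree of a face in an abstract edge set `ξ`. [KhS21 p0003:L91] [cite: KhristoforovSmirnov2021, §1.2 (colourings ↔ loop configurations, pp. 3–4)] -/
def xiDeg (ξ : Finset (Sym2 (Site 2))) (F : HexVertex) : ℕ :=
  #((Finset.univ : Finset (Fin 3)).filter fun j => s(faceVertex F (j + 1), faceVertex F (j + 2)) ∈ ξ)

open Classical in
/-- **`W_Ω(y_{r+1},…,y_{r+4})`**: edge sets of `H_G` whose odd-degree faces are exactly the four colour-change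
corners. [KhS21 p0003:L95–L98 «W_Ω(U) := {ξ ⊂ HalfEdges(Ω) : ∂ξ = U}»] [cite: KhristoforovSmirnov2021, §1.2 (colourings ↔ loop configurations, pp. 3–4)] -/
def loopSpace (r : Fin 5) : Finset (Finset (Sym2 (Site 2))) :=
  (hBonds D).powerset.filter fun ξ => ∀ F : HexVertex, F ∈ triFacesTouching D.verts →
    (Odd (xiDeg ξ F) ↔ ∃ j : Fin 5, j ≠ r ∧ IsCornerFace D j F)

/-- (A-image) `ξ_{r,c}(σ)` has disorders exactly at the four corners (= (P) restated for `xiOf`). SIZE S given (P). [cite: KhristoforovSmirnov2021, §1.2 Lemma 2 (p. 4)] -/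
def LoopImage (D : TriMarkedDomain 5) : Prop :=
  ∀ (σ : SiteConfig (Site 2)) (r : Fin 5) (c : Bool), xiOf D σ r c ∈ loopSpace D r

/-- **(A-inj)** the colouring of `G` is determined by its loop configuration (flood fill from the boundary
condition: `G` is connected and meets the boundary). SIZE S–M. WHY IT MIGHT FAIL: no. [KhS21 p0004:L37 «This map is a bijection»] [cite: KhristoforovSmirnov2021, §1.2 Lemma 2 (p. 4)] -/
def LoopInj (D : TriMarkedDomain 5) : Prop :=
  ∀ (σ σ' : SiteConfig (Site 2)) (r : Fin 5) (c : Bool), xiOf D σ r c = xiOf D σ' r c →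
    ∀ u ∈ D.verts, (u ∈ σ ↔ u ∈ σ')

/-- **(A-surj)** every edge set with the right disorders is the loop configuration of a colouring. Mechanism:
define the colour of a cell by the parity of `ξ`-crossings along any dual path from the outer boundary;
well-definedness = every closed dual circuit crosses `ξ ⊕ ξ_{r,c}(∅)` evenly = the union of hexagons is simply
connected (`TriMarkedDomain.euler`, cycle space of `H_G` generated by hexagon boundaries). SIZE M–L (the one piece
of planar homology). WHY IT MIGHT FAIL: not for B–R domains (simply connected by `euler`); it WOULD fail for an
annulus. [KhS21 p0004:L10–L14 «ξ₁ ⊕ ξ₂ is a union of loops … exactly 2^{#Faces(Ω)} loop configurations»] [cite: KhristoforovSmirnov2021, §1.2 Lemma 2 (p. 4)] -/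
def LoopSurj (D : TriMarkedDomain 5) : Prop :=
  ∀ (r : Fin 5) (c : Bool), ∀ ξ ∈ loopSpace D r, ∃ σ : SiteConfig (Site 2), xiOf D σ r c = ξ

/-- **(A-count)** «exactly `2^{#Faces(Ω)}` loop configurations with given disorders». SIZE S given (A-inj),
(A-surj), (A-image). [KhS21 p0004:L13–L14] [cite: KhristoforovSmirnov2021, §1.2 Lemma 2 (p. 4)] -/
def LoopCount (D : TriMarkedDomain 5) : Prop := ∀ r : Fin 5, #(loopSpace D r) = 2 ^ #D.verts

/-- Linking inside an abstract edge set `ξ`: faces joined by a chain of `H`-edges whose dual bonds lie in `ξ`. [cite: KhristoforovSmirnov2021, §1.2 (colourings ↔ loop configurations, pp. 3–4)] -/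
def XiLinked (ξ : Finset (Sym2 (Site 2))) (Y Y' : HexVertex) : Prop :=
  Relation.ReflTransGen
    (fun F F' => ∃ j : Fin 3, F' = oppFace F j ∧ s(faceVertex F (j + 1), faceVertex F (j + 2)) ∈ ξ) Y Y'

/-- Link pattern B = [u₁↔u₄, u₂↔u₃] of an abstract loop configuration (reference corner `r`). [KhS21 p0004:L22–L25] [cite: KhristoforovSmirnov2021, §1.2 (colourings ↔ loop configurations, pp. 3–4)] -/
def XiPatternB (r : Fin 5) (ξ : Finset (Sym2 (Site 2))) : Prop :=
  ∃ Y₁ Y₄ : HexVertex, IsCornerFace D (r + 1) Y₁ ∧ IsCornerFace D (r + 4) Y₄ ∧ XiLinked ξ Y₁ Y₄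

open Classical in
/-- **KhS21 LEMMA 2, AS PRINTED (k = 4, per corner `r`, x = n = 1)**:
`P^perc_Ω[∂_{u₁u₂}Ω ↔ ∂_{u₃u₄}Ω] = P^loop_{Ω,{u₁,…,u₄}}[u₁↔u₄, u₂↔u₃]` — the open-crossing probability
`A_{r+1} ↔ A_{r+3}` at `p = 1/2` equals the fraction of loop configurations with disorders at the four corners
having pattern B. From (A-inj)+(A-surj)+(A-image), (B-open)+(B-reach)+(B-unique) and the product structure of
`triSitePercolation half` on the finitely many cells of `G`. SIZE M (assembly). [KhS21 §1.2 Lemma 2 p0004:L22–L31] [cite: KhristoforovSmirnov2021, §1.2 Lemma 2 (p. 4)] -/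
def KhSLemma2Face (D : TriMarkedDomain 5) : Prop :=
  ∀ r : Fin 5,
    D.openCrossingProb (r + 1) (r + 3) =
      (#((loopSpace D r).filter fun ξ => XiPatternB D r ξ) : ℝ) / #(loopSpace D r)

/-! ### ed.3 addendum (a-idea-2 g10, 19:00Z): LOCALITY and the FINITE RUNG

The (v-c) target quantifies over ALL `σ : SiteConfig (Site 2) = Set (Site 2)`; every predicate in it reads `σ` only on
the sites of `G` (`Bicol` on cells of `D.verts`, outer hexagons coloured by `arcColour`; b-step0 S0 09a5c968 Part C proves
the boundedness of `IStep`/`HStep` on `hexBall1Five`). The two LOCALITY faces below make that explicit, and reduce the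
target to a statement over the FINITELY many sub-configurations `S ∈ D.verts.powerset` — the shape in which the smallest
domains are decided by `decide` (RUNG: `FiveMarkedLoopLemmaFin hexBall1Five`, 2⁷ configurations × 5 corners, tree
`TriHexBallDomain.hexBall1Five` once p338066 lands; `hexBall2Five` (19 sites, p335895) is 2¹⁹ × 5 — kernel-heavy, not a
`decide` target). A rung sits OUTSIDE the regime where (v-c) is known (nothing is known), exercises every definition of
D1-v2 at once, and is the natural first B text after (P)/(P′). -/

/-- (L1) the link patterns see `σ` only through `σ ∩ G`. SIZE S (induction on `Relation.ReflTransGen (IStep …)`;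
`Bicol D σ …` unfolds to cell colours of sites of `D.verts` or `arcColour`). [cite: KhristoforovSmirnov2021, §1.2 Lemma 2 (p. 4)] -/
def LoopLocal (D : TriMarkedDomain 5) : Prop :=
  ∀ (σ : SiteConfig (Site 2)) (r : Fin 5) (c : Bool),
    (MatchA D σ r c ↔ MatchA D (σ ∩ ↑D.verts) r c) ∧ (MatchB D σ r c ↔ MatchB D (σ ∩ ↑D.verts) r c)

/-- (L2) crossings of `G` see `σ` only through `σ ∩ G` (tree `TriMarkedDomain.IsOpenCrossing/IsClosedCrossing` are
paths INSIDE `D.verts`). SIZE XS–S. [cite: KhristoforovSmirnov2021, §1.2 Lemma 2 (p. 4)] -/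
def CrossLocal (D : TriMarkedDomain 5) : Prop :=
  ∀ (σ : SiteConfig (Site 2)) (i j : Fin 5),
    (D.IsOpenCrossing σ i j ↔ D.IsOpenCrossing (σ ∩ ↑D.verts) i j) ∧
      (D.IsClosedCrossing σ i j ↔ D.IsClosedCrossing (σ ∩ ↑D.verts) i j)

/-- **(v-c) FINITE FORM**: the loop lemma over the sub-configurations `S ⊆ D.verts` only (what `decide` can see on a
concrete `D`). [cite: KhristoforovSmirnov2021, §1.2 Lemma 2 (p. 4)] -/
def FiveMarkedLoopLemmaFin (D : TriMarkedDomain 5) : Prop :=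
  ∀ S ∈ D.verts.powerset, ∀ r : Fin 5,
    Xor (MatchA D (↑S : Set (Site 2)) r false) (MatchB D (↑S : Set (Site 2)) r false) ∧
    (MatchB D (↑S : Set (Site 2)) r false ↔ D.IsOpenCrossing (↑S : Set (Site 2)) (r + 1) (r + 3)) ∧
    (MatchA D (↑S : Set (Site 2)) r false ↔
      (D.IsClosedCrossing (↑S : Set (Site 2)) (r + 2) (r + 4) ∨ D.IsClosedCrossing (↑S : Set (Site 2)) (r + 2) r))

open Classical in
/-- **finite form + locality ⇒ (v-c)** — real proof. [cite: KhristoforovSmirnov2021, §1.2 Lemma 2 (p. 4)] -/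
theorem loop5_of_fin (hL : LoopLocal D) (hC : CrossLocal D) (h : FiveMarkedLoopLemmaFin D) :
    FiveMarkedLoopLemma D := by
  intro σ r
  set S : Finset (Site 2) := D.verts.filter (fun v => v ∈ σ) with hSdef
  have hS : (↑S : Set (Site 2)) = σ ∩ ↑D.verts := by
    ext v
    simp [hSdef, and_comm]
  have hmem : S ∈ D.verts.powerset := Finset.mem_powerset.2 (Finset.filter_subset _ _)
  have h' := h S hmem r
  rw [hS] at h'
  obtain ⟨hA, hB⟩ := hL σ r false
  obtain ⟨hO13, -⟩ := hC σ (r + 1) (r + 3)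
  obtain ⟨-, hC24⟩ := hC σ (r + 2) (r + 4)
  obtain ⟨-, hC2r⟩ := hC σ (r + 2) r
  rw [hA, hB, hO13, hC24, hC2r]
  exact h'

/-- conversely the finite form is a special case (sanity: the reduction loses nothing). [cite: KhristoforovSmirnov2021, §1.2 Lemma 2 (p. 4)] -/
theorem fin_of_loop5 (h : FiveMarkedLoopLemma D) : FiveMarkedLoopLemmaFin D :=
  fun S _ r => h (↑S) r

/-- (L2) holds for EVERY domain: the tree crossings already read `↑D.verts ∩ ω`. Real proof, XS. [cite: KhristoforovSmirnov2021, §1.2 (colourings ↔ loop configurations, pp. 3–4)] -/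
theorem crossLocal_holds : CrossLocal D := by
  intro σ i j
  have h1 : ((D.verts : Set (Site 2)) ∩ (σ ∩ ↑D.verts)) = (↑D.verts ∩ σ) := by
    ext v; simp only [Set.mem_inter_iff, Finset.mem_coe]; tauto
  have h2 : ((D.verts : Set (Site 2)) ∩ (σ ∩ ↑D.verts)ᶜ) = (↑D.verts ∩ σᶜ) := by
    ext v; simp only [Set.mem_inter_iff, Set.mem_compl_iff, Finset.mem_coe, not_and]; tauto
  refine ⟨?_, ?_⟩
  · simp only [TriMarkedDomain.IsOpenCrossing, h1]
  · simp only [TriMarkedDomain.IsClosedCrossing, h2]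

/-- hence (v-c) ⇐ (L1) + the finite form. [cite: KhristoforovSmirnov2021, §1.2 Lemma 2 (p. 4)] -/
theorem loop5_of_fin' (hL : LoopLocal D) (h : FiveMarkedLoopLemmaFin D) : FiveMarkedLoopLemma D :=
  loop5_of_fin D hL (crossLocal_holds D) h

end Literature.Probability.Percolation.FivePoint

end

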